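import Summits.Ventures.HodgeRepro2.T6N41PlaceSplitMain
import Summits.Ventures.HodgeRepro2.T6N41PlaceToy

/-!
# T6N41PlaceSplitToy — non-vacuity witnesses for the split layer and for the whole placement (README §10.5(ii)(c)/(d))

A toy N4.1 datum with TWO places, both unramified (`ι = Bool`, `S = ∅`): the place `false` INERT in `E` (one prime
`0` of norm `2`), the place `true` SPLIT (two primes `1 = 𝔓₁`, `2 = 𝔓₂` of norm `2`; `κ = Fin 3`); the doubling
factors `L_v = f²` (inert) and `f⁴` (split) with `f = (1 − 2^{−s})⁻¹`, the Hecke factors `f` resp. `f²`, every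
Satake parameter and Hecke value `1`.  Over it: a placement datum (`RepGL = ℂˣ × ℂˣ`, `ps = Prod.mk`), an inert
datum at the prime `0` (`RepU = ℂˣ × ℂˣ`, `π_v = (1, 1)`, `JH 𝔓 a = univ` iff `a = −1`, `BCrog = (−1, −1)`,
`χHarris = −1`, `ξV = γD = −1` at `0` and `1` at `1, 2`, `ωt = 1`) and a split datum at the primes `1, 2`
(`psF = Prod.mk`, `θII β = (1, β⁻¹)`, `Θ` = the twist formula with `μ₁ = μ₂ = 1`, `β′_v = 1`, `ι₁ = id`, `ι₂` =
componentwise inverse, `ωc = ` the product; the Langlands-quotient carrier `LQ a b = (a, b)`) — on which every elementary / definitional / compat field is PROVED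
(not assumed), ALL SIX displays of the placement (LR §7, Bump (5.22), Harris II (2.2.5)(b), Rogawski §11.4,
Mínguez Thm 1 (2), Bump Thm 4.5.1) hold, each NON-VACUOUSLY (the inert prime feeds Harris / Rogawski, the split
primes feed Mínguez / Bump 4.5.1), the dichotomy `hdich` is the real case split `𝔓 = 0 ∨ 𝔓 ≠ 0`, and the residual `hκ` holds
(`γ_D(𝔓₁) = 1 = μ₂`): (c) `SplitDatum In` is instantiable, (d) the hypotheses of `satake_split` and of
`N41_placement_split` are jointly satisfiable, and the conclusion at BOTH unramified places is obtained by
applying the theorem.  No display is closed by `trivial` / `simp` / `decide` / `exact ⟨⟩` on a general datum —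
each proof uses the toy's specific data.

§8(d): uses an L-value-free non-vanishing device: NO.
-/

namespace Summit.Ventures.HodgeRepro2.T6
namespace N41PlaceToy

/-- The prime-to-place map of the toy: `0 ↦ false` (inert), `1, 2 ↦ true` (split). -/
def bIS (𝔓 : Fin 3) : Bool := decide (𝔓 ≠ 0)

/-- The fibre above the inert place is `{0}`. -/
theorem fiber_false : (Set.toFinite (bIS ⁻¹' {false})).toFinset = {0} := by
  ext 𝔓
  fin_cases 𝔓 <;> simp [bIS]

/-- The fibre above the split place is `{1, 2}`. -/
theorem fiber_true : (Set.toFinite (bIS ⁻¹' {true})).toFinset = {1, 2} := by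
  ext 𝔓
  fin_cases 𝔓 <;> simp [bIS]

/-- The toy N4.1 datum with an inert and a split place, both NOT in `S`. -/
noncomputable def toyDatumIS : DoublingLDatum Bool where
  S := ∅
  Lv := fun v s => if v then (f s * f s) * (f s * f s) else f s * f s
  L := fun _ => 1
  thetaNonzero := fun _ => True
  L₁ := fun _ => 1
  L₂ := fun _ => 1
  g₁ := fun v s => if v then f s * f s else f s
  g₂ := fun v s => if v then f s * f s else f s
  triv₁ := False
  triv₂ := False

/-- The toy placement datum: three primes of norm `2`; `RepGL = ℂˣ × ℂˣ`, `ps = Prod.mk`, `LGL` = Bump's (5.22)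
on the pair; `BCχ = (1, 1)`; `η₁ = η₂ = 1`. -/
@[reducible] noncomputable def toyPlIS : PlacementDatum toyDatumIS where
  κ := Fin 3
  b := bIS
  fin := fun _ => Set.toFinite _
  N := fun _ => 2
  one_lt_N := fun _ => by norm_num
  RepGL := fun _ => ℂˣ × ℂˣ
  ps := fun _ a b => (a, b)
  LGL := fun _ p s => (1 - (p.1 : ℂ) * (2 : ℂ) ^ (-s))⁻¹ * (1 - (p.2 : ℂ) * (2 : ℂ) ^ (-s))⁻¹
  BCχ := fun _ => (1, 1)
  LGLv := fun v s => if v then (f s * f s) * (f s * f s) else f s * f s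
  LGLv_eq := fun v => by
    funext s
    cases v
    · rw [fiber_false, Finset.prod_singleton]
      simp [f]
    · rw [fiber_true, Finset.prod_pair (by decide)]
      simp [f]
  α := fun _ => 1
  β := fun _ => 1
  BCχ_ps := fun _ _ => rfl
  η₁ := fun _ => 1
  η₂ := fun _ => 1
  g₁_eq := fun v _ => by
    funext s
    cases v
    · rw [fiber_false, Finset.prod_singleton]
      simp [toyDatumIS, f]
    · rw [fiber_true, Finset.prod_pair (by decide)]
      simp [toyDatumIS, f]
  g₂_eq := fun v _ => by
    funext s
    cases v
    · rw [fiber_false, Finset.prod_singleton]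
      simp [toyDatumIS, f]
    · rw [fiber_true, Finset.prod_pair (by decide)]
      simp [toyDatumIS, f]

/-- The toy inert datum over `toyPlIS`: the prime `0` is inert. -/
@[reducible] noncomputable def toyInIS : InertDatum toyPlIS where
  inert := fun 𝔓 => 𝔓 = 0
  RepU := fun _ => ℂˣ × ℂˣ
  π := fun _ => (1, 1)
  JH := fun _ a => if a = -1 then Set.univ else ∅
  BCrog := fun _ _ => (-1, -1)
  twist := fun _ p ξ => (p.1 * ξ, p.2 * ξ)
  twist_ps := fun _ _ _ _ => rfl
  ps_inj := fun _ a b c d h => Or.inl ⟨congrArg Prod.fst h, congrArg Prod.snd h⟩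
  χHarris := fun _ => -1
  ξV := fun 𝔓 => if 𝔓 = 0 then -1 else 1
  γD := fun 𝔓 => if 𝔓 = 0 then -1 else 1
  ωt := fun _ => 1
  βTrivial := fun _ => True
  thetaLift := fun _ => True
  thetaLift_all := fun _ => trivial
  βTrivial_of := fun _ _ _ => trivial
  χHarris_eq := fun _ _ _ => rfl
  ξV_eq := fun _ h _ => by simp [h]
  γD_eq := fun _ h _ => by simp [h]
  ωt_eq := fun _ _ => rfl
  η₂_def := fun _ h _ => by simp [toyPlIS, h]
  η₁_def := fun _ h _ => by simp [toyPlIS, h]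
  BCχ_eq := fun _ h _ => by simp [toyPlIS, h]

/-- The toy split datum over `toyInIS`: the place `true` is split with the primes `1 = 𝔓₁`, `2 = 𝔓₂`. -/
@[reducible] noncomputable def toySpIS : SplitDatum toyInIS where
  splitPlace := fun v => v = true
  p₁ := fun _ => 1
  p₂ := fun _ => 2
  b_p₁ := fun v hv => by subst hv; rfl
  b_p₂ := fun v hv => by subst hv; rfl
  p₁_ne_p₂ := fun _ _ => by decide
  fiber_split := fun 𝔓 h => by
    fin_cases 𝔓
    · exact absurd h (by simp [bIS])
    · exact Or.inl rfl
    · exact Or.inr rfl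
  not_inert := fun 𝔓 h h0 => by
    subst h0
    simp [bIS] at h
  psF := fun _ a b => (a, b)
  twistF := fun _ p ξ => (p.1 * ξ, p.2 * ξ)
  twistF_ps := fun _ _ _ _ => rfl
  ωc := fun _ p => p.1 * p.2
  ωc_ps := fun _ _ _ => rfl
  θII := fun _ β => (1, β⁻¹)
  Θ := fun _ β => ((1 : ℂˣ) * 1, (β * (1 : ℂˣ)⁻¹)⁻¹ * 1)
  βv := fun _ => 1
  βv_unit := fun _ _ _ => by simp
  π_Θ := fun _ _ _ _ => by simp [toyInIS]
  μ₁ := fun _ => 1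
  μ₂ := fun _ => 1
  μ₁_unit := fun _ _ _ => by simp
  Θ_eq := fun _ _ _ _ => rfl
  ι₁ := fun _ p => p
  ι₂ := fun _ p => (p.1⁻¹, p.2⁻¹)
  ι₁_ps := fun _ _ _ => rfl
  ι₂_ps := fun _ _ _ => rfl
  BCχ_p₁ := fun _ _ _ => by simp [toyPlIS]
  BCχ_p₂ := fun _ _ _ => by simp [toyPlIS]
  ωt_p₁ := fun _ _ _ => by simp
  ωt_p₂ := fun _ _ _ => by simp
  γD_p₂ := fun _ _ _ => by simp
  η₂_def := fun 𝔓 h _ => by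
    have h0 : 𝔓 ≠ 0 := of_decide_eq_true h
    simp [toyPlIS, h0]
  η₁_def := fun 𝔓 h _ => by
    have h0 : 𝔓 ≠ 0 := of_decide_eq_true h
    simp [toyPlIS, h0]

/-- Lapid–Rallis §7 holds on the toy: `L_v = LGLv` at both places by construction. -/
theorem toyIS_LR7 : Hyp.LapidRallis2005_Sec7_Unramified toyDatumIS toyPlIS := fun _ _ => rfl

/-- Bump (5.22) holds on the toy. -/
theorem toyIS_Bump : Hyp.Bump1997_5_22 toyPlIS := fun _ _ _ => rfl

/-- Harris II (2.2.5)(b) holds on the toy at its inert prime: `π_v ∈ JH 𝔓 (χ′/χ)` since `χHarris = −1` selects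
`Set.univ`. -/
theorem toyIS_Harris : Hyp.HarrisII2007_Prop2_2_5_b toyInIS := by
  intro 𝔓 _ _ _ _
  change (1, 1) ∈ (if ((-1 : ℂˣ)) = -1 then (Set.univ : Set (ℂˣ × ℂˣ)) else ∅)
  rw [if_pos rfl]
  exact Set.mem_univ _

/-- Rogawski §11.4 holds on the toy at its inert prime: the only non-empty packet is `JH 𝔓 (−1)`, whose lift
`(−1, −1)` is `ps 𝔓 (−1) (−1)⁻¹`. -/
theorem toyIS_Rogawski : Hyp.Rogawski1990_Sec11_4_BC toyInIS := by
  intro 𝔓 _ a _ ρ hρ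
  by_cases ha : a = -1
  · subst ha
    simp [toyPlIS]
  · change ρ ∈ (if a = -1 then (Set.univ : Set (ℂˣ × ℂˣ)) else ∅) at hρ
    rw [if_neg ha] at hρ
    exact hρ.elim

/-- The toy Langlands-quotient carrier: `LQ a b = (a, b)` (every principal series of the toy is its own
Langlands quotient). -/
@[reducible] noncomputable def toyLQIS : SplitLQ toySpIS where
  LQ := fun _ a b => (a, b)

/-- Mínguez Thm 1 (2) holds on the toy at its split place: `θII β = (1, β⁻¹) = LQ 1 β⁻¹` by construction. -/
theorem toyIS_Minguez : Hyp.Minguez2008_Thm1_2_LQ toyLQIS := fun _ _ _ => rfl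

/-- Bump Thm 4.5.1 holds on the toy: `LQ a b = (a, b) = psF a b` by construction (for every `a, b`, in
particular outside the two reducible cases). -/
theorem toyIS_Bump451 : Hyp.Bump1997_Thm4_5_1 toyLQIS := fun _ _ _ _ _ _ => rfl

/-- The residual (A″κ) holds on the toy: `γ_D(𝔓₁) = 1 = μ₂`. -/
theorem toyIS_kappa : ∀ v, toySpIS.splitPlace v → v ∉ toyDatumIS.S →
    toyInIS.γD (toySpIS.p₁ v) = toySpIS.μ₂ v := fun _ _ _ => by
  simp

/-- The dichotomy on the toy: every prime is inert (`= 0`) or above the split place (`≠ 0`). -/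
theorem toyIS_dich : ∀ 𝔓, toyPlIS.b 𝔓 ∉ toyDatumIS.S → toyInIS.inert 𝔓 ∨ toySpIS.splitPlace (toyPlIS.b 𝔓) :=
  fun 𝔓 _ => by
    by_cases h : 𝔓 = 0
    · exact Or.inl h
    · exact Or.inr (decide_eq_true h)

/-- The Satake identity at the toy's split primes, obtained from `satake_split`. -/
theorem toyIS_satake_split : ∀ 𝔓, toySpIS.splitPlace (toyPlIS.b 𝔓) → toyPlIS.b 𝔓 ∉ toyDatumIS.S →
    (toyPlIS.α 𝔓 = toyPlIS.η₁ 𝔓 ∧ toyPlIS.β 𝔓 = toyPlIS.η₂ 𝔓) ∨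
      (toyPlIS.α 𝔓 = toyPlIS.η₂ 𝔓 ∧ toyPlIS.β 𝔓 = toyPlIS.η₁ 𝔓) :=
  N41Place.satake_split toyLQIS toyIS_Minguez toyIS_Bump451 toyIS_kappa

/-- **(d) for the whole placement:** the hypotheses of `N41_placement_split` hold jointly on the toy — all six
displays, the real dichotomy, the residual — and its conclusion is obtained by applying the theorem. -/
theorem toyIS_placement_split :
    ∀ v ∉ toyDatumIS.S, ∀ s : ℂ, toyDatumIS.Lv v s = toyDatumIS.g₁ v s * toyDatumIS.g₂ v s :=
  N41Place.N41_placement_split toyDatumIS toyPlIS toyInIS toySpIS toyLQIS toyIS_LR7 toyIS_Bump toyIS_Harris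
    toyIS_Rogawski toyIS_Minguez toyIS_Bump451 toyIS_dich toyIS_kappa

/-- The conclusion at the toy's split place, non-vacuous (`true ∉ ∅`). -/
theorem toyIS_placement_at_split (s : ℂ) :
    toyDatumIS.Lv true s = toyDatumIS.g₁ true s * toyDatumIS.g₂ true s :=
  toyIS_placement_split true (Finset.notMem_empty _) s

/-- The conclusion at the toy's inert place, non-vacuous (`false ∉ ∅`). -/
theorem toyIS_placement_at_inert (s : ℂ) :
    toyDatumIS.Lv false s = toyDatumIS.g₁ false s * toyDatumIS.g₂ false s :=
  toyIS_placement_split false (Finset.notMem_empty _) s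

end N41PlaceToy
end Summit.Ventures.HodgeRepro2.T6
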